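import Mathlib
import Summits.NavierStokesRegularity.NavierStokesRegularity.Theorems.EulerZoomLiouvillePowerGaugeEulerLiouvilleSelfSimilarNoDriftBadNode
import Summits.NavierStokesRegularity.NavierStokesRegularity.Theorems.EulerZoomLiouvillePowerGaugeEulerLiouvilleSelfSimilarLimitSetKill
import HarnessLib.Audit

/-!
# Rung C1 of the crux `EulerZoomLiouville.PowerGaugeEulerLiouville`, NO-DRIFT lane (3e): the convergence theorem WITHOUT
# the far-field bounds (3.8) — bounded velocity, bounded gradient, pressure bounded above suffice

Route №10 `EulerZoomLiouville` (NavierStokesRegularity), crux E = stmt-NavierStokesRegularity-19832, tenure rung C1,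
registered residue `stub_selfSimilarExtremalRest`.  Lineage ns-typeII-p2 (gen 7).  Sequel of `…SelfSimilarNoDriftBadNode`
(3d): there `tendsto_flow_atBot_of_curl_ne_zero` used CIV's far field (3.8) only to call ns-typeII-p1's LIMIT-SET KILL
in its far-field form.  But p1's `NodalContinuum.exists_mapClusterPt_stretching_ge_one` is a TRAJECTORY-LEVEL statement
(a backward trajectory bounded for `t ≥ 0` through a vortical point has a BAD limit node), and in the `Kelvin` setting
(`V` smooth, `‖V‖ ≤ M`, `‖DV‖ ≤ K`, `P ≤ P₀`, `0 < γ < ½`) backward trajectories are bounded by the Bernoulli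
function (`norm_flow_le_of_nonpos`).  Hence:

* **`tendsto_flow_atBot_of_curl_ne_zero_of_bounded`** — `0 < γ < ½`, `(V, P)` a self-similar Euler profile with `V`
  smooth and bounded, `DV` bounded, `P` bounded above: the backward trajectory of EVERY vortical point converges to ONE
  bad stagnation point.  No far-field decay, no hypothesis on the stagnation set.

So the classical C1 endgame needs (3.8) only in its final harmonic-Liouville step (and there `V` bounded + `P ≤ P₀`
already force a curl- and divergence-free profile to vanish: `V` is then a bounded harmonic field, hence constant `a`,
and `(1−γ)a + ∇P = 0` with `P` bounded above gives `a = 0` — left to the assembly).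
WHAT THIS IS NOT: not NS, not E, not rung C1. [folklore; ConstantinIgnatovaVicol2026Putative §3.4.3 (3.31) (Bernoulli
confinement of backward trajectories)]
-/

noncomputable section

-- flat `Theorems/<Route><Decl>…` files of one crux share the namespace of the crux (tree convention)
set_option linter.dupNamespace false

open MeasureTheory Set Filter Topology Metric Function InnerProductSpace
open scoped RealInnerProductSpace NNReal ContDiff

namespace Summit.NavierStokesRegularity.NavierStokesRegularity.Theorems.PowerGaugeEulerLiouville.NoDrift

open Literature.Analysis Literature.Analysis.FluidPDE
open Summit.NavierStokesRegularity.NavierStokesRegularity.Theorems.PowerGaugeEulerLiouville.Kelvin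

variable {γ : ℝ} {V : EuclideanSpace ℝ (Fin 3) → EuclideanSpace ℝ (Fin 3)} {P : EuclideanSpace ℝ (Fin 3) → ℝ}

/-- **EVERY VORTICAL PARTICLE'S BACKWARD TRAJECTORY CONVERGES TO ONE BAD STAGNATION POINT — bounded-profile form.**
`0 < γ < ½`; `(V, P)` a self-similar Euler profile (CIV (3.3)) with `V` smooth, `‖V‖ ≤ M`, `‖DV‖ ≤ K`, `P ≤ P₀`; `x`
with `curl V x ≠ 0`.  Then `Φₛ x → z` as `s → −∞` for a stagnation point `z` carrying a unit `w` with
`⟪DV(z) w, w⟫ ≥ 1`.  (p1's trajectory-level LIMIT-SET KILL on the Bernoulli-bounded backward trajectory, then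
`tendsto_flow_atBot_of_badClusterPt`.) [folklore; ConstantinIgnatovaVicol2026Putative §3.4.3 (3.31)] -/
theorem tendsto_flow_atBot_of_curl_ne_zero_of_bounded (hV : ContDiff ℝ ∞ V) {K : ℝ} (hK : ∀ y, ‖fderiv ℝ V y‖ ≤ K)
    (hprof : IsSelfSimilarEulerProfile γ 0 V P) {M P₀ : ℝ} (hM : ∀ y, ‖V y‖ ≤ M) (hP : ∀ y, P y ≤ P₀)
    (hγ : 0 < γ) (hγ2 : γ < 1 / 2) {x : EuclideanSpace ℝ (Fin 3)} (hx : curl V x ≠ 0) :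
    ∃ z ∈ selfSimilarNodalSet γ 0 V, (∃ w : EuclideanSpace ℝ (Fin 3), ‖w‖ = 1 ∧ 1 ≤ ⟪fderiv ℝ V z w, w⟫) ∧
      Tendsto (fun s => ODE.evolutionMap (fun _ : ℝ => selfSimilarTransport γ 0 V) 0 s x) atBot (𝓝 z) := by
  set Φ := ODE.evolutionMap (fun _ : ℝ => selfSimilarTransport γ 0 V) 0 with hΦ
  -- the backward trajectory `Y t = Φ (−t) x` is bounded for `t ≥ 0`
  set Y : ℝ → EuclideanSpace ℝ (Fin 3) := fun t => Φ (-t) x with hYdef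
  have hY : ∀ t, HasDerivAt Y ((-1 : ℝ) • selfSimilarTransport γ 0 V (Y t)) t :=
    fun t => hasDerivAt_flow_neg (γ := γ) hV hK x t
  set B : ℝ := max 1 ((γ * M + |1 / 2 * M ^ 2 + P₀| + |selfSimilarBernoulli γ 0 V P x| + 1) / (γ * (1 / 2 - γ)))
    with hB
  have hBd : ∀ t : ℝ, 0 ≤ t → ‖Y t‖ ≤ B := fun t ht =>
    norm_flow_le_of_nonpos hV hK hprof hM hP hγ hγ2 x (by linarith)
  have hx0 : curl V (Y 0) ≠ 0 := by
    have h0 : Y 0 = x := by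
      change Φ (-0) x = x
      rw [neg_zero, hΦ, ODE.evolutionMap_self]
    rw [h0]; exact hx
  -- p1's trajectory-level LIMIT-SET KILL
  obtain ⟨z', -, -, hcl', w, hw, hbadw⟩ :=
    NodalContinuum.exists_mapClusterPt_stretching_ge_one hprof (ne_of_lt hγ2) hY hBd hx0
  have hcl : MapClusterPt z' atBot (fun s => Φ s x) := by
    have e : Y = (fun s => Φ s x) ∘ Neg.neg := rfl
    rw [e, mapClusterPt_comp, Filter.map_neg_atTop] at hcl'
    exact hcl'
  obtain ⟨z, hzN, hz⟩ := tendsto_flow_atBot_of_badClusterPt hV hK hprof hM hP hγ hγ2 x hcl hw hbadw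
  have hzz' : z' = z := eq_of_nhds_neBot (hcl.clusterPt.mono hz)
  exact ⟨z, hzN, ⟨w, hw, hzz' ▸ hbadw⟩, hz⟩

end Summit.NavierStokesRegularity.NavierStokesRegularity.Theorems.PowerGaugeEulerLiouville.NoDrift

end
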